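import Mathlib
import HarnessLib
import Summits.AtomisticToContinuum.Crystallization.Theses.GappedShellCensus

/-!
# Sketch — crux-ideate round 1, ideator 1, crux `GappedShellCensus.FiveFoldRationingR`
(item stmt-AtomisticToContinuum-18071).

First lemmas of the idea cards
* `Ideas/cage-calculus-cellulation.md` (Card A: cavities of an all-gapped-twelve configuration are
  empty near-unit deltahedral cages; Brianchon–Gram + per-vertex kissing bookkeeping kill every cage;
  cavity-free ⇒ T/O cellulation with ring words (2,2)/(5,0) — and, for free, torn-free), and
* `Ideas/pole-clique-rationing.md` (Card B: on a cavity-free configuration the five-bond graph is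
  2-regular on its support — `n₅ ∈ {0, 2}` by ring-slot double counting and the non-embeddability of a
  near-unit `K₅` / of a near-unit octahedron inscribed in a unit shell — so the five-locus is a
  disjoint union of ideal geodesics and the filed global engines apply).

Nothing deep is proved here: `theorem`s ending in `sorry` are SIGNATURES that must elaborate; the two
compositions at the end are kernel-checked.  Constants are the crux's: tolerance `1/50`, gap `63/50`,
scale `a > 0`.
-/

noncomputable section

open scoped BigOperators
open Filter Set Function

namespace Summit.AtomisticToContinuum.Crystallization.Cruxes.FiveFoldRationingR.Sketch

open Summit.AtomisticToContinuum.Crystallization.Theses.GappedShellCensus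

local notation "E³" => EuclideanSpace ℝ (Fin 3)

/-! ### The crux, split into named blocks (verbatim sub-formulas of `FiveFoldRationingR`) -/

/-- `w` is a BOND partner of `y` at scale `a`. -/
def Bonded (a : ℝ) (y w : E³) : Prop := w ≠ y ∧ dist y w ≤ a * (1 + 1 / 50)

/-- common bond partners of the bond `(y, v)` — the set the crux counts. -/
def commonNbrs (a : ℝ) (Y : Set E³) (y v : E³) : Set E³ :=
  {w ∈ Y | w ≠ y ∧ w ≠ v ∧ dist y w ≤ a * (1 + 1 / 50) ∧ dist v w ≤ a * (1 + 1 / 50)}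

/-- GAPPED-TWELVE at scale `a` (the crux's third hypothesis, verbatim). -/
def GappedTwelve (a : ℝ) (Y : Set E³) : Prop :=
  ∀ y ∈ Y, ({w ∈ Y | w ≠ y ∧ dist y w ≤ a * (1 + 1 / 50)}.ncard = 12 ∧
    ∀ w ∈ Y, w ≠ y → a * (1 - 1 / 50) ≤ dist y w ∧
      (dist y w ≤ a * (1 + 1 / 50) ∨ a * (63 / 50) ≤ dist y w))

/-- TORN-FREE (the crux's fourth hypothesis, verbatim). -/
def TornFree' (a : ℝ) (Y : Set E³) : Prop :=
  ∀ y ∈ Y, ∀ v ∈ Y, v ≠ y → dist y v ≤ a * (1 + 1 / 50) →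
    4 ≤ {w ∈ Y | w ≠ y ∧ w ≠ v ∧ dist y w ≤ a * (1 + 1 / 50) ∧ dist v w ≤ a * (1 + 1 / 50)}.ncard

/-- FIVE-FREE BALLS OF EVERY RADIUS (the crux's conclusion, verbatim). -/
def FiveFreeBalls (a : ℝ) (Y : Set E³) : Prop :=
  ∀ R : ℝ, ∃ c ∈ Y, ∀ y ∈ Y, dist y c ≤ R → ∀ v ∈ Y, v ≠ y → dist y v ≤ a * (1 + 1 / 50) →
    {w ∈ Y | w ≠ y ∧ w ≠ v ∧ dist y w ≤ a * (1 + 1 / 50) ∧ dist v w ≤ a * (1 + 1 / 50)}.ncard ≤ 4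

/-- Sanity (kernel-checked): the crux is literally these blocks. -/
theorem crux_iff :
    FiveFoldRationingR ↔
      ∀ (Y : Set E³) (a : ℝ), 0 < a → Y.Nonempty → GappedTwelve a Y → TornFree' a Y →
        FiveFreeBalls a Y :=
  Iff.rfl

/-! ### Card A — cage calculus: the cellulation (ring alphabet) from cavity exclusion -/

/-- RING ALPHABET at the bond `(y, v)`: its common partners `C` are either a closed five-ring
(`|C| = 5`, every partner bonded to exactly two partners: word `(5,0)`), or four partners carrying
exactly two bonded pairs (words `TOTO` / `TTOO`) whose "octahedral" gaps — non-bonded partner pairs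
at distance `≤ 8a/5`, i.e. `≈ √2·a`, as opposed to the `≈ √3·a` pairs across the bond — are closed by
a genuine sixth octahedron vertex `z ∈ Y` beyond the gap.  This is the conclusion "no cavity borders
the bond `(y,v)`": the cells around the bond are tetrahedra and completed octahedra filling `2π`. -/
def RingAlphabetAt (a : ℝ) (Y : Set E³) (y v : E³) : Prop :=
  ((commonNbrs a Y y v).ncard = 5 ∧
      ∀ c ∈ commonNbrs a Y y v, {d ∈ commonNbrs a Y y v | Bonded a c d}.ncard = 2) ∨
    ((commonNbrs a Y y v).ncard = 4 ∧
      {p : E³ × E³ | p.1 ∈ commonNbrs a Y y v ∧ p.2 ∈ commonNbrs a Y y v ∧ Bonded a p.1 p.2}.ncard = 4 ∧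
      ∀ c ∈ commonNbrs a Y y v, ∀ d ∈ commonNbrs a Y y v, c ≠ d → ¬ Bonded a c d →
        dist c d ≤ a * (8 / 5) →
          ∃ z ∈ Y, z ≠ y ∧ Bonded a z v ∧ Bonded a z c ∧ Bonded a z d ∧ a * (63 / 50) ≤ dist y z)

/-- CAVITY-FREE (Card A's target `C⁺`): in an ALL-gapped-twelve configuration every bond is
surrounded by cells only.  NOTE: no torn-free hypothesis — torn bonds border cavities, so this
statement also yields the route's crux `TornFree` (see `tornFree_of_cavityFree`). -/
def CavityFree : Prop :=
  ∀ (Y : Set E³) (a : ℝ), 0 < a → GappedTwelve a Y → ∀ y ∈ Y, ∀ v ∈ Y, Bonded a y v →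
    RingAlphabetAt a Y y v

/-- Kernel-checked: cavity-free ⇒ torn-free (the crux's own fourth hypothesis becomes redundant). -/
theorem tornFree_of_cavityFree (h : CavityFree) :
    ∀ (Y : Set E³) (a : ℝ), 0 < a → GappedTwelve a Y → TornFree' a Y := by
  intro Y a ha hG y hy v hv hvy hdist
  change 4 ≤ (commonNbrs a Y y v).ncard
  rcases h Y a ha hG y hy v hv ⟨hvy, hdist⟩ with ⟨h5, -⟩ | ⟨h4, -⟩ <;> omega

/-- Card A, stub 1 (signature) — CAVITIES ARE BOUNDED: the covering radius of an all-gapped-twelve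
configuration is `< 2a`.  Mechanism: a site on the wall of a hole of radius `≥ 2a` would keep its
twelve band-neighbours inside a closed half-space up to `O(1/ρ)`, against the ONE-SIDED KISSING
NUMBER `B(3) = 9 < 12` (Bezdek, Classical Topics in Discrete Geometry, Thm 1.2.1; tolerant form
`≤ 10` at `2 %` to be certified). -/
theorem noDeepHoles :
    ∀ (Y : Set E³) (a : ℝ), 0 < a → Y.Nonempty → GappedTwelve a Y →
      ∀ x : E³, ∃ y ∈ Y, dist x y < 2 * a := by
  sorry

/-- Card A, stub 2 (signature) — TOLERANT ONE-SIDED KISSING: at most ten `2 %`-band neighbours of a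
site lie in a closed half-space through it (exact touching: nine). -/
theorem oneSidedKissing_band (y : E³) (S : Finset E³)
    (hband : ∀ w ∈ S, 49 / 50 ≤ dist y w ∧ dist y w ≤ 51 / 50)
    (hsep : ∀ w ∈ S, ∀ w' ∈ S, w ≠ w' → 49 / 50 ≤ dist w w')
    (n : E³) (hn : n ≠ 0) (hhalf : ∀ w ∈ S, 0 ≤ inner ℝ n (w - y)) : S.card ≤ 10 := by
  sorry

/-- Card A, stub 3 (signature) — THE GAP KILLS THE SEVEN-CAGE: no empty pentagonal-bipyramid cage,
i.e. five sites pairwise-consecutively bonded around two common partners `p, q` force `p, q` bonded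
(then the five tetrahedra are CELLS, a closed five-ring) — because the bipyramid's apex distance
`1.05a` sits in the forbidden annulus and stretching it to `≥ 1.26a` breaks an apex–ring bond. -/
theorem no_pentagonalBipyramid_cavity (a : ℝ) (ha : 0 < a) (p q : E³) (c : Fin 5 → E³)
    (hpc : ∀ i, Bonded a p (c i)) (hqc : ∀ i, Bonded a q (c i))
    (hring : ∀ i, Bonded a (c i) (c (i + 1))) (hpq : p ≠ q)
    (hcore : a * (1 - 1 / 50) ≤ dist p q)
    (hgap : dist p q ≤ a * (1 + 1 / 50) ∨ a * (63 / 50) ≤ dist p q) :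
    dist p q ≤ a * (1 + 1 / 50) := by
  sorry

/-! ### Card B — pole cliques: `n₅ ∈ {0, 2}` and the hand-over to the global engine -/

/-- the FIVE-BONDS at `y`: bond partners `v` of `y` whose bond has five common partners. -/
def fiveBonds (a : ℝ) (Y : Set E³) (y : E³) : Set E³ :=
  {v ∈ Y | Bonded a y v ∧ (commonNbrs a Y y v).ncard = 5}

/-- Card B, geometric core 1 (signature) — no near-unit `K₅` in `ℝ³`: five points pairwise at
distance in `[0.98, 1.02]` do not exist (the regular 4-simplex needs `ℝ⁴`; best 3-D five-point
near-unit set is the triangular bipyramid with one pair at `1.633`).  Kills `n₅ = 4` (four poles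
pairwise bonded + the centre) and every pole clique `K₄`. -/
theorem no_nearUnit_K5 :
    ¬ ∃ p : Fin 5 → E³, ∀ i j, i ≠ j → (49 : ℝ) / 50 ≤ dist (p i) (p j) ∧ dist (p i) (p j) ≤ 51 / 50 := by
  sorry

/-- Card B, geometric core 2 (signature) — no near-unit OCTAHEDRON inscribed in a unit shell: six
shell points of `y` (distances to `y` in the band) whose bond graph is `K₂,₂,₂` (all pairs bonded
except the three "antipodal" ones `(0,1), (2,3), (4,5)`) do not exist (a near-unit octahedron has
circumradius `≈ 0.707a`, not `≈ a`).  Kills the only `K₄`-free pole graph at `n₅ = 6`. -/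
theorem no_shellOctahedron (y : E³) (p : Fin 6 → E³)
    (hshell : ∀ i, (49 : ℝ) / 50 ≤ dist y (p i) ∧ dist y (p i) ≤ 51 / 50)
    (hbond : ∀ i j : Fin 6, i ≠ j → (i.val / 2 ≠ j.val / 2) →
      (49 : ℝ) / 50 ≤ dist (p i) (p j) ∧ dist (p i) (p j) ≤ 51 / 50) : False := by
  sorry

/-- Card B, structural consequence (signature) — FIVE-BONDS COME IN ANTIPODAL PAIRS OR NOT AT ALL:
on a cavity-free all-gapped-twelve configuration every site has zero or exactly two five-bonds, and
two five-bonds at a site point to nearly antipodal poles (combinatorial bicapped pentagonal prism;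
`|p − q| ≥ 1.9a`).  Ring-slot double counting: a `2T+2Q` shell vertex lies in at most one pole ring,
so `n₅` poles need `≥ (5n₅ − 12 + n₅)/2` pole–pole bonds: `n₅ = 4 ⇒ K₄` (core 1), `n₅ = 6 ⇒ K₄` or
`K₂,₂,₂` (cores 1, 2), `n₅ ≥ 8 ⇒` the poles' bond graph triangulates the shell sphere with `≤ 16`
triangles of area `≤ 0.612 sr < 4π/16`; `n₅ = 2 ⇒` poles at graph distance three. -/
theorem fiveBonds_zero_or_antipodalPair (hC : CavityFree) :
    ∀ (Y : Set E³) (a : ℝ), 0 < a → GappedTwelve a Y → ∀ y ∈ Y,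
      fiveBonds a Y y = ∅ ∨
        ((fiveBonds a Y y).ncard = 2 ∧
          ∀ p ∈ fiveBonds a Y y, ∀ q ∈ fiveBonds a Y y, p ≠ q → a * (19 / 10) ≤ dist p q) := by
  sorry

/-- THE GLOBAL ENGINE, as imported (signature of what the filed cards
`Cruxes/FiveFoldRationing/Ideas/convex-chamber-rod-rigidity.md` / `geodesic-cycle-gauss-bonnet.md`
prove from their local lemma `L1`, which is `CavityFree` here): on a cavity-free all-gapped-twelve
configuration — a face-to-face T/O cellulation of `ℝ³` with ring words `(2,2)/(5,0)` only, whose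
ideal metric is a flat cone structure with cone angle `5θ_T < 2π` along a 2-regular geodesic
five-locus (Card B) — the five-locus is not `R`-dense for any `R`. -/
def RationingOfAlphabet : Prop :=
  ∀ (Y : Set E³) (a : ℝ), 0 < a → Y.Nonempty → GappedTwelve a Y →
    (∀ y ∈ Y, ∀ v ∈ Y, Bonded a y v → RingAlphabetAt a Y y v) → FiveFreeBalls a Y

/-- Kernel-checked composition: Card A's target + the global engine give the crux BY NAME (the
crux's torn-free hypothesis is not even used — it is implied, `tornFree_of_cavityFree`). -/
theorem fiveFoldRationingR_of (hC : CavityFree) (hG : RationingOfAlphabet) : FiveFoldRationingR := by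
  intro Y a ha hne hgap _htorn
  exact hG Y a ha hne hgap (fun y hy v hv hb => hC Y a ha hgap y hy v hv hb)

end Summit.AtomisticToContinuum.Crystallization.Cruxes.FiveFoldRationingR.Sketch
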